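import Literature.NumberTheory.EllipticCurves.KrizLi2019.SexticTwistBSDThreeDescent
import HarnessLib

/-!
# Sub-lane «bsd-p2»: the height–index relation over a quadratic field WITH THE `2`-POWER EXPOSED —
# `k² · #E(K)_tors² · ĥ_K(P) = 2 · [E(K):ℤP]² · Reg(E/F)` with `k ∈ {1, 2}` and
# `k = 2 ⟺ E(F) ⊆ 2E(K) + E(K)_tors` (the halvability bit, decidable per pair)

HONEST FRAMING (sub-lane «bsd-p2», run/shared/lean/b2b/bsd-rank1-residual/p2/, verbatim in every
file): the target of record is the FULL Birch–Swinnerton-Dyer formula for EVERY analytic-rank `≤ 1`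
`E/ℚ` at ALL primes INCLUDING `2`; the odd-prime class ledger is referee A's; the `2`-part is OPEN
(cells O1 = X5 ∖ CM and O12 = the CM corner) and under census by «bsd-p2». Census / instrument
output at `2` = EVIDENCE / conjecture items with held-out validation, NEVER a Literature fact;
certificates close PAIRS (one isogeny class, `p = 2`), never classes. This file asserts NO
arithmetic fact and takes NO named fact: it is the tree's THEOREM
`KrizLi2019.exists_mul_canonicalHeight_eq_index_sq_mul_regulator` ("`m · #E(K)_tors² · ĥ_K(P) =
2 · [E(K):ℤP]² · Reg(E/F)` for some `m ∈ {1, 4}`") RE-PROVED with the `2`-power `m = k²` EXPOSED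
and CHARACTERISED: `k = 2` exactly when every `F`-rational point is halvable in `E(K)` modulo
torsion. At an ODD prime `m` is a unit and the tree's consumers
(`X11b.exists_shaAn_padicVal_eq_of_heegner`, additive-p1's rank-one / rank-zero identities) rightly
ignore it; at `p = 2` it is one of the bits the exact Gross–Zagier index identity must carry
(mandate (i): "Gross–Zagier heights at 2", exact). Sequel `P2/HeegnerIndexAtTwo.lean` consumes it.
Nothing booked; no mark moved. Unit `b2b-bsdres-p2-typer` GEN 2; NEW file.

Proof (as in the tree's lemma, Gross–Zagier 1986 V.§2 p. 311 bookkeeping): `g` generates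
`E(F)/tors`, `g_K` generates `E(K)/tors`; the conjugation `σ` of `K/F` fixes `ι g ≡ k g_K`, so
`σ g_K ≡ g_K`, `g_K + σ g_K ≡ 2 g_K` is `F`-rational, whence `jk = 2` and `|k| ∈ {1, 2}`;
`ĥ_K(ι g) = 2 ĥ_F(g) = 2 Reg(E/F)` and `ĥ_K(P) = a² ĥ_K(g_K)` for `P ≡ a g_K`, `[E(K):ℤP] = |a|·#tors`.
NEW: `|k| = 2 ⟺ ι g ∈ 2E(K) + tors ⟺ ι(E(F)) ⊆ 2E(K) + tors`.

References: Gross–Zagier, Invent. Math. 84 (1986) V.§2 (p. 311) [GrossZagier1986]; Silverman *AEC*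
VIII.6, VIII.9, Ex. 10.16 [SilvermanAEC2009]; HOME/p2/idea-2/ROUTES.md §0 K-c ("the index
`m_K = [E(K)/tors : ℤP_K]` (2-part decided by 2-division tests in `E(K)`)").
-/

noncomputable section

open scoped Classical

open WeierstrassCurve NumberField Literature.NumberTheory.EllipticCurves
  Literature.NumberTheory.EllipticCurves.KrizLi2019
  Literature.NumberTheory.QuadraticFields

set_option autoImplicit false

namespace Summit.BirchSwinnertonDyer.Rank1Residual.P2

variable {F : Type} [Field F] [NumberField F] (W : WeierstrassCurve F) [W.IsElliptic]
  (K : Type) [Field K] [NumberField K] [Algebra F K]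

/-- **Height–index relation in rank one over a quadratic field, `2`-power exposed.** Let `K/F` be a
quadratic extension of number fields and `E/F` elliptic with `rank E(K) = rank E(F) = 1`, and let
`P ∈ E(K)` have infinite order. Then there is `k ∈ {1, 2}` with
`k² · #E(K)_tors² · ĥ_K(P) = 2 · [E(K) : ℤP]² · Reg(E/F)`, and `k = 2` EXACTLY WHEN every
`F`-rational point is divisible by `2` in `E(K)` modulo torsion (`ι(E(F)) ⊆ 2E(K) + E(K)_tors`,
`ι = QuadraticDescent.incl`) — equivalently when a generator of `E(F)/tors` becomes halvable in
`E(K)/tors`. (`ĥ_K` = canonical height over `K`, `= 2ĥ_F` on `F`-points; `Reg(E/F) = ĥ_F(g)`.)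
[cite: GrossZagier1986, V.§2 (p. 311)] [cite: SilvermanAEC2009, Exercise 10.16 and Thm. VIII.9.3] -/
theorem exists_halvingIndex_canonicalHeight_eq_index_sq_mul_regulator (h2 : Module.finrank F K = 2)
    (hrK : (W.baseChange K).mordellWeilRank = 1) (hrQ : W.mordellWeilRank = 1)
    (P : (W.baseChange K).toAffine.Point) (hP : ¬ IsOfFinAddOrder P) :
    ∃ k : ℕ, (k = 1 ∨ k = 2) ∧
      (k = 2 ↔ ∀ y : W.toAffine.Point, ∃ Q : (W.baseChange K).toAffine.Point,
        QuadraticDescent.incl K W y - (2 : ℤ) • Q ∈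
          AddCommGroup.torsion (W.baseChange K).toAffine.Point) ∧
      (k : ℝ) ^ 2 * ((W.baseChange K).torsionOrder : ℝ) ^ 2 * P.canonicalHeight =
        2 * ((AddSubgroup.zmultiples P).index : ℝ) ^ 2 * W.regulator := by
  haveI : (W.baseChange K).IsElliptic := isElliptic_baseChange' W K
  haveI : NeZero (2 : F) := ⟨two_ne_zero⟩
  -- generators over `K` and over `F`
  obtain ⟨gK, hgK, hgenK, huniqK, -⟩ :=
    exists_generator_regulator_eq_of_mordellWeilRank_eq_one (W.baseChange K) hrK
  obtain ⟨g, hg, hgen, huniq, hreg⟩ := exists_generator_regulator_eq_of_mordellWeilRank_eq_one W hrQ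
  set T := AddCommGroup.torsion (W.baseChange K).toAffine.Point with hT_def
  set ι : W.toAffine.Point →+ (W.baseChange K).toAffine.Point := QuadraticDescent.incl K W
    with hι_def
  -- a square-root generator of `K` and the conjugation `σ`
  obtain ⟨θ, c, hθ, hc⟩ := Quadratic.exists_sq_eq_algebraMap (F := F) (K := K) h2
  set σ : (W.baseChange K).toAffine.Point →+ (W.baseChange K).toAffine.Point :=
    Affine.Point.map (W' := W) (Quadratic.conj h2 hθ hc) with hσ_def
  have hσι : ∀ y : W.toAffine.Point, σ (ι y) = ι y := fun y =>
    Affine.Point.map_baseChange (W' := W) (Quadratic.conj h2 hθ hc) y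
  have hσσ : ∀ x, σ (σ x) = x := fun x =>
    QuadraticDescent.conjMap_conjMap W (Quadratic.conj_conj h2 hθ hc) x
  -- `σ` preserves torsion, hence respects congruences modulo `T`
  have hσT : ∀ {x y : (W.baseChange K).toAffine.Point}, x - y ∈ T → σ x - σ y ∈ T := by
    intro x y hxy
    rw [← map_sub]
    exact (AddCommGroup.mem_torsion _).mpr (σ.isOfFinAddOrder ((AddCommGroup.mem_torsion _).mp hxy))
  -- `ι` maps torsion to torsion
  have hιT : ∀ {x y : W.toAffine.Point}, x - y ∈ AddCommGroup.torsion W.toAffine.Point →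
      ι x - ι y ∈ T := by
    intro x y hxy
    rw [← map_sub]
    exact (AddCommGroup.mem_torsion _).mpr (ι.isOfFinAddOrder ((AddCommGroup.mem_torsion _).mp hxy))
  -- coefficients: `P ≡ a gK`, `ι g ≡ k gK`, `σ gK ≡ e gK`
  obtain ⟨a, ha⟩ := hgenK P
  obtain ⟨k, hk⟩ := hgenK (ι g)
  obtain ⟨e, he⟩ := hgenK (σ gK)
  -- uniqueness of coefficients modulo `T`
  have hcoef : ∀ {x : (W.baseChange K).toAffine.Point} {u v : ℤ},
      x - u • gK ∈ T → x - v • gK ∈ T → u = v := by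
    intro x u v hu hv
    have hmem : (u - v) • gK ∈ T := by
      have : (u - v) • gK = (x - v • gK) - (x - u • gK) := by rw [sub_smul]; abel
      rw [this]; exact T.sub_mem hv hu
    have := huniqK (u - v) hmem
    omega
  -- `a ≠ 0` and `k ≠ 0`
  have ha0 : a ≠ 0 := by
    rintro rfl
    rw [zero_smul, sub_zero] at ha
    exact hP ((AddCommGroup.mem_torsion _).mp ha)
  have hιg : ¬ IsOfFinAddOrder (ι g) := fun hfin =>
    hg ((Affine.Point.map_injective (W' := W) _).isOfFinAddOrder_iff.mp hfin)
  have hk0 : k ≠ 0 := by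
    rintro rfl
    rw [zero_smul, sub_zero] at hk
    exact hιg ((AddCommGroup.mem_torsion _).mp hk)
  -- `e = 1`: apply `σ` to `ι g ≡ k gK`
  have he1 : e = 1 := by
    have h1 : σ (ι g) - k • σ gK ∈ T := by
      have := hσT hk
      rwa [map_zsmul] at this
    rw [hσι] at h1
    have h2' : ι g - (k * e) • gK ∈ T := by
      have hke : k • σ gK - (k * e) • gK ∈ T := by
        have : k • σ gK - (k * e) • gK = k • (σ gK - e • gK) := by
          rw [mul_smul, smul_sub]
        rw [this]
        exact T.zsmul_mem he k
      have : ι g - (k * e) • gK = (ι g - k • σ gK) + (k • σ gK - (k * e) • gK) := by abel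
      rw [this]; exact T.add_mem h1 hke
    have hkk : k = k * e := hcoef hk h2'
    have : k * (e - 1) = 0 := by linear_combination -hkk
    rcases mul_eq_zero.mp this with h | h
    · exact absurd h hk0
    · linarith
  -- `gK + σ gK` is `F`-rational and `≡ 2 gK`
  have hfix : σ (gK + σ gK) = gK + σ gK := by rw [map_add, hσσ, add_comm]
  obtain ⟨y, hy⟩ := AddMonoidHom.mem_range.mp
    (mem_range_incl_of_map_conj_eq W K h2 hθ hc (gK + σ gK) hfix)
  obtain ⟨j, hj⟩ := hgen y
  have hy1 : ι y - (j * k) • gK ∈ T := by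
    have hA : ι y - j • ι g ∈ T := by
      have := hιT hj
      rwa [map_zsmul] at this
    have hB : j • ι g - (j * k) • gK ∈ T := by
      have : j • ι g - (j * k) • gK = j • (ι g - k • gK) := by rw [mul_smul, smul_sub]
      rw [this]; exact T.zsmul_mem hk j
    have : ι y - (j * k) • gK = (ι y - j • ι g) + (j • ι g - (j * k) • gK) := by abel
    rw [this]; exact T.add_mem hA hB
  have hy2 : ι y - (2 : ℤ) • gK ∈ T := by
    rw [hy]
    have : gK + σ gK - (2 : ℤ) • gK = σ gK - e • gK := by rw [he1, two_zsmul, one_zsmul]; abel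
    rw [this]; exact he
  have hjk : j * k = 2 := hcoef hy1 hy2
  -- hence `|k| ∈ {1, 2}`
  have hkabs : k.natAbs = 1 ∨ k.natAbs = 2 := by
    have hkdvd : k ∣ 2 := ⟨j, by rw [mul_comm]; exact hjk.symm⟩
    have hkabs' : k.natAbs ∣ 2 := by exact_mod_cast Int.natAbs_dvd_natAbs.mpr hkdvd
    have hle : k.natAbs ≤ 2 := Nat.le_of_dvd two_pos hkabs'
    have hpos : 0 < k.natAbs := Int.natAbs_pos.mpr hk0
    interval_cases h : k.natAbs
    · exact Or.inl rfl
    · exact Or.inr rfl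
  -- heights: `ĥ(P) = a² ĥ(gK)`, `ĥ(ι g) = k² ĥ(gK) = 2 ĥ_F(g) = 2 Reg`
  have hhP : P.canonicalHeight = (a : ℝ) ^ 2 * gK.canonicalHeight :=
    canonicalHeight_eq_of_sub_zsmul_mem_torsion (W.baseChange K) ha
  have hhg : (ι g).canonicalHeight = (k : ℝ) ^ 2 * gK.canonicalHeight :=
    canonicalHeight_eq_of_sub_zsmul_mem_torsion (W.baseChange K) hk
  have hhg2 : (ι g).canonicalHeight = 2 * g.canonicalHeight := by
    have h := Affine.Point.canonicalHeight_baseChange (R := F) (K := F) (L := K) (W := W) g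
    rw [h2] at h
    exact_mod_cast h
  -- index: `[E(K) : ℤP] = |a| · #T`
  have hidx : (AddSubgroup.zmultiples P).index = a.natAbs * (W.baseChange K).torsionOrder :=
    index_zmultiples_eq (W.baseChange K) hgK hgenK ha0 ha
  refine ⟨k.natAbs, hkabs, ?_, ?_⟩
  · ------------------------------------------------------------ the halvability characterisation
    constructor
    · -- `|k| = 2`: every `F`-point `y ≡ j' g` has `ι y ≡ j' k gK = 2 • (± j' gK)`
      intro hk2 y'
      obtain ⟨j', hj'⟩ := hgen y'
      have hk' : k = 2 ∨ k = -2 := by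
        rcases Int.natAbs_eq k with h | h <;> rw [hk2] at h <;> [left; right] <;> exact_mod_cast h
      have hιy' : ι y' - (j' * k) • gK ∈ T := by
        have hA : ι y' - j' • ι g ∈ T := by
          have := hιT hj'
          rwa [map_zsmul] at this
        have hB : j' • ι g - (j' * k) • gK ∈ T := by
          have : j' • ι g - (j' * k) • gK = j' • (ι g - k • gK) := by rw [mul_smul, smul_sub]
          rw [this]; exact T.zsmul_mem hk j'
        have : ι y' - (j' * k) • gK = (ι y' - j' • ι g) + (j' • ι g - (j' * k) • gK) := by abel
        rw [this]; exact T.add_mem hA hB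
      rcases hk' with rfl | rfl
      · refine ⟨j' • gK, ?_⟩
        have : (2 : ℤ) • (j' • gK) = (j' * 2) • gK := by rw [mul_comm, mul_smul]
        rw [this]; exact hιy'
      · refine ⟨(-j') • gK, ?_⟩
        have : (2 : ℤ) • ((-j') • gK) = (j' * (-2)) • gK := by
          rw [smul_smul]; congr 1; ring
        rw [this]; exact hιy'
    · -- halvable: `ι g ≡ 2 • Q`, `Q ≡ b gK` ⇒ `k = 2b` ⇒ `|k| = 2`
      intro hhalf
      obtain ⟨Q, hQ⟩ := hhalf g
      obtain ⟨b, hb⟩ := hgenK Q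
      have h2Q : ι g - (2 * b) • gK ∈ T := by
        have hB : (2 : ℤ) • Q - (2 * b) • gK ∈ T := by
          have : (2 : ℤ) • Q - (2 * b) • gK = (2 : ℤ) • (Q - b • gK) := by rw [mul_smul, smul_sub]
          rw [this]; exact T.zsmul_mem hb 2
        have : ι g - (2 * b) • gK = (ι g - (2 : ℤ) • Q) + ((2 : ℤ) • Q - (2 * b) • gK) := by abel
        rw [this]; exact T.add_mem hQ hB
      have hkb : k = 2 * b := hcoef hk h2Q
      rcases hkabs with h1 | h2'
      · exfalso
        rcases Int.natAbs_eq k with h | h <;> rw [h1] at h <;> omega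
      · exact h2'
  · ------------------------------------------------------------ the identity
    have hcast : ((k.natAbs : ℕ) : ℝ) ^ 2 = (k : ℝ) ^ 2 := by
      rw [Nat.cast_natAbs, Int.cast_abs, sq_abs]
    rw [hcast, hidx, hreg, hhP]
    have hasq : ((a.natAbs : ℕ) : ℝ) ^ 2 = (a : ℝ) ^ 2 := by
      rw [Nat.cast_natAbs, Int.cast_abs, sq_abs]
    push_cast
    rw [mul_pow]
    have key : (k : ℝ) ^ 2 * gK.canonicalHeight = 2 * g.canonicalHeight := by rw [← hhg, hhg2]
    calc (k : ℝ) ^ 2 * ((W.baseChange K).torsionOrder : ℝ) ^ 2 * ((a : ℝ) ^ 2 * gK.canonicalHeight)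
        = ((W.baseChange K).torsionOrder : ℝ) ^ 2 * (a : ℝ) ^ 2 *
            ((k : ℝ) ^ 2 * gK.canonicalHeight) := by ring
      _ = 2 * ((a.natAbs : ℝ) ^ 2 * ((W.baseChange K).torsionOrder : ℝ) ^ 2) *
            g.canonicalHeight := by rw [key, hasq]; ring

/-- **The halvability bit is live only when `#E(K)_tors` is even** (REFUTER-O1 v25 §180 rider HI-R1,
made a kernel theorem): in rank one over the quadratic extension `K/F`, if `#E(K)_tors` is ODD then NO
`F`-rational generator is halvable in `E(K)` modulo torsion — so the `k` of
`exists_halvingIndex_canonicalHeight_eq_index_sq_mul_regulator` is `1`. Proof: if `ι g ≡ 2Q (mod T)`,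
then `t := σQ − Q ∈ T` (σ acts as `+1` on `E(K)/T ≅ ℤ`) with `σt = −t`; for `#T` odd, `t = 2t′` with
`σt′ = −t′`, and `Q + t′` is `σ`-fixed, hence `F`-rational, making `g` halvable in `E(F)/tors` — absurd
for a generator. (In particular on every row with `E(ℚ)[2] = 0` — the `surj8 / surjNot8 / cyclic3`
columns — the bit is `k = 1`; it is a genuine datum only on `borel` rows.)
[cite: SilvermanAEC2009, Exercise 10.16] [cite: GrossZagier1986, V.§2 (p. 311)] -/
theorem not_forall_halvable_of_odd_torsionOrder (h2 : Module.finrank F K = 2)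
    (hrK : (W.baseChange K).mordellWeilRank = 1) (hrQ : W.mordellWeilRank = 1)
    (hodd : Odd (W.baseChange K).torsionOrder) :
    ¬ ∀ y : W.toAffine.Point, ∃ Q : (W.baseChange K).toAffine.Point,
        QuadraticDescent.incl K W y - (2 : ℤ) • Q ∈
          AddCommGroup.torsion (W.baseChange K).toAffine.Point := by
  intro hhalf
  haveI : (W.baseChange K).IsElliptic := isElliptic_baseChange' W K
  haveI : NeZero (2 : F) := ⟨two_ne_zero⟩
  obtain ⟨gK, hgK, hgenK, huniqK, -⟩ :=
    exists_generator_regulator_eq_of_mordellWeilRank_eq_one (W.baseChange K) hrK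
  obtain ⟨g, hg, hgen, huniq, -⟩ := exists_generator_regulator_eq_of_mordellWeilRank_eq_one W hrQ
  set T := AddCommGroup.torsion (W.baseChange K).toAffine.Point with hT_def
  set ι : W.toAffine.Point →+ (W.baseChange K).toAffine.Point := QuadraticDescent.incl K W
    with hι_def
  obtain ⟨θ, c, hθ, hc⟩ := Quadratic.exists_sq_eq_algebraMap (F := F) (K := K) h2
  set σ : (W.baseChange K).toAffine.Point →+ (W.baseChange K).toAffine.Point :=
    Affine.Point.map (W' := W) (Quadratic.conj h2 hθ hc) with hσ_def
  have hσι : ∀ y : W.toAffine.Point, σ (ι y) = ι y := fun y =>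
    Affine.Point.map_baseChange (W' := W) (Quadratic.conj h2 hθ hc) y
  have hσσ : ∀ x, σ (σ x) = x := fun x =>
    QuadraticDescent.conjMap_conjMap W (Quadratic.conj_conj h2 hθ hc) x
  have hσT : ∀ {x y : (W.baseChange K).toAffine.Point}, x - y ∈ T → σ x - σ y ∈ T := by
    intro x y hxy
    rw [← map_sub]
    exact (AddCommGroup.mem_torsion _).mpr (σ.isOfFinAddOrder ((AddCommGroup.mem_torsion _).mp hxy))
  have hσmem : ∀ {x : (W.baseChange K).toAffine.Point}, x ∈ T → σ x ∈ T := fun {x} hx =>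
    (AddCommGroup.mem_torsion _).mpr (σ.isOfFinAddOrder ((AddCommGroup.mem_torsion _).mp hx))
  obtain ⟨k, hk⟩ := hgenK (ι g)
  obtain ⟨e, he⟩ := hgenK (σ gK)
  have hcoef : ∀ {x : (W.baseChange K).toAffine.Point} {u v : ℤ},
      x - u • gK ∈ T → x - v • gK ∈ T → u = v := by
    intro x u v hu hv
    have hmem : (u - v) • gK ∈ T := by
      have : (u - v) • gK = (x - v • gK) - (x - u • gK) := by rw [sub_smul]; abel
      rw [this]; exact T.sub_mem hv hu
    have := huniqK (u - v) hmem
    omega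
  have hιg : ¬ IsOfFinAddOrder (ι g) := fun hfin =>
    hg ((Affine.Point.map_injective (W' := W) _).isOfFinAddOrder_iff.mp hfin)
  have hk0 : k ≠ 0 := by
    rintro rfl
    rw [zero_smul, sub_zero] at hk
    exact hιg ((AddCommGroup.mem_torsion _).mp hk)
  -- `e = 1`
  have he1 : e = 1 := by
    have h1 : σ (ι g) - k • σ gK ∈ T := by
      have := hσT hk
      rwa [map_zsmul] at this
    rw [hσι] at h1
    have h2' : ι g - (k * e) • gK ∈ T := by
      have hke : k • σ gK - (k * e) • gK ∈ T := by
        have : k • σ gK - (k * e) • gK = k • (σ gK - e • gK) := by rw [mul_smul, smul_sub]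
        rw [this]; exact T.zsmul_mem he k
      have : ι g - (k * e) • gK = (ι g - k • σ gK) + (k • σ gK - (k * e) • gK) := by abel
      rw [this]; exact T.add_mem h1 hke
    have hkk : k = k * e := hcoef hk h2'
    have : k * (e - 1) = 0 := by linear_combination -hkk
    rcases mul_eq_zero.mp this with h | h
    · exact absurd h hk0
    · linarith
  -- the halving point `Q` and the torsion element `t = σQ − Q` with `σt = −t`
  obtain ⟨Q, hQ⟩ := hhalf g
  obtain ⟨b, hb⟩ := hgenK Q
  have hσQ : σ Q - Q ∈ T := by
    have h1 : σ Q - b • σ gK ∈ T := by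
      have := hσT hb
      rwa [map_zsmul] at this
    have h3 : b • σ gK - b • gK ∈ T := by
      have : b • σ gK - b • gK = b • (σ gK - e • gK) := by rw [he1, one_smul, smul_sub]
      rw [this]; exact T.zsmul_mem he b
    have : σ Q - Q = (σ Q - b • σ gK) + (b • σ gK - b • gK) - (Q - b • gK) := by abel
    rw [this]; exact T.sub_mem (T.add_mem h1 h3) hb
  set t := σ Q - Q with ht_def
  have hσt : σ t = -t := by
    simp only [ht_def, map_sub, hσσ]; abel
  -- `#T` odd: `t = 2 • t'` with `t' ∈ T`, `σ t' = −t'`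
  set N := Nat.card T with hN_def
  have hNodd : Odd N := hodd
  have hNt : N • t = 0 := by
    have hx := addOrderOf_dvd_natCard (⟨t, hσQ⟩ : T)
    rw [addOrderOf_dvd_iff_nsmul_eq_zero] at hx
    have hval := congrArg Subtype.val hx
    rw [AddSubmonoidClass.coe_nsmul] at hval
    exact hval
  obtain ⟨M, hM⟩ := hNodd
  set t' := (M + 1) • t with ht'_def
  have ht'T : t' ∈ T := T.nsmul_mem hσQ _
  have h2t' : (2 : ℤ) • t' = t := by
    have : (2 : ℤ) • t' = (N + 1) • t := by
      rw [ht'_def, hM, two_zsmul, ← add_nsmul]; congr 1; ring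
    rw [this, add_nsmul, hNt, one_nsmul, zero_add]
  have hσt' : σ t' = -t' := by
    rw [ht'_def, map_nsmul, hσt, neg_nsmul]
  -- `Q' = Q + t'` is `σ`-fixed, hence `F`-rational
  have hfix : σ (Q + t') = Q + t' := by
    rw [map_add, hσt']
    have : σ Q = Q + t := by rw [ht_def]; abel
    rw [this, ← h2t', two_zsmul]; abel
  obtain ⟨q', hq'⟩ := AddMonoidHom.mem_range.mp
    (mem_range_incl_of_map_conj_eq W K h2 hθ hc (Q + t') hfix)
  -- then `g ≡ 2 q'` modulo torsion in `E(F)`: absurd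
  have hιdiff : ι (g - (2 : ℤ) • q') ∈ T := by
    have : ι (g - (2 : ℤ) • q') = (ι g - (2 : ℤ) • Q) - (2 : ℤ) • t' := by
      rw [map_sub, map_zsmul, hq', smul_add]; abel
    rw [this]; exact T.sub_mem hQ (T.zsmul_mem ht'T 2)
  have hdiff : g - (2 : ℤ) • q' ∈ AddCommGroup.torsion W.toAffine.Point :=
    (AddCommGroup.mem_torsion _).mpr
      ((Affine.Point.map_injective (W' := W) _).isOfFinAddOrder_iff.mp
        ((AddCommGroup.mem_torsion _).mp hιdiff))
  obtain ⟨n, hn⟩ := hgen q'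
  have hmem : (1 - 2 * n) • g ∈ AddCommGroup.torsion W.toAffine.Point := by
    have : (1 - 2 * n) • g = (g - (2 : ℤ) • q') + (2 : ℤ) • (q' - n • g) := by
      rw [sub_smul, one_smul, mul_smul, smul_sub]; abel
    rw [this]
    exact (AddCommGroup.torsion W.toAffine.Point).add_mem hdiff
      ((AddCommGroup.torsion W.toAffine.Point).zsmul_mem hn 2)
  have := huniq (1 - 2 * n) hmem
  omega

/-- Hence, when `#E(K)_tors` is odd, the `k` of the height–index relation is `1`:
`#E(K)_tors² · ĥ_K(P) = 2 · [E(K):ℤP]² · Reg(E/F)`. [cite: GrossZagier1986, V.§2 (p. 311)] -/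
theorem canonicalHeight_eq_index_sq_mul_regulator_of_odd_torsionOrder (h2 : Module.finrank F K = 2)
    (hrK : (W.baseChange K).mordellWeilRank = 1) (hrQ : W.mordellWeilRank = 1)
    (hodd : Odd (W.baseChange K).torsionOrder)
    (P : (W.baseChange K).toAffine.Point) (hP : ¬ IsOfFinAddOrder P) :
    ((W.baseChange K).torsionOrder : ℝ) ^ 2 * P.canonicalHeight =
      2 * ((AddSubgroup.zmultiples P).index : ℝ) ^ 2 * W.regulator := by
  obtain ⟨k, hk12, hkiff, hheight⟩ :=
    exists_halvingIndex_canonicalHeight_eq_index_sq_mul_regulator W K h2 hrK hrQ P hP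
  have hk1 : k = 1 := by
    rcases hk12 with h | h
    · exact h
    · exact absurd (hkiff.mp h) (not_forall_halvable_of_odd_torsionOrder W K h2 hrK hrQ hodd)
  rw [hk1] at hheight
  simpa using hheight

end Summit.BirchSwinnertonDyer.Rank1Residual.P2

end
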